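import Summits.QuantumFields.YangMills.Theorems.LuscherReductionTwistedTraceScalingBOStiffMehlerExit
import HarnessLib

/-!
# (B-ST) flat Poincaré atom (B2): the EXIT MASS of the flat product kernel `J ⊗ D_ZD_Z'/M_Z` from a core-stable set (box → ball)
# (lane A of S-BASE, crux `TwistedTraceScaling` stmt-QuantumFields-20203, C4-CORE, the (B-ST) pen; HANDOFF-g21 'REMAINING ANALYTIC ATOMS' (B2), hand C `…-w3`)

After the tensorisation ✓`…TensorPoincareSlack.variance_tensor_le_slack` the flat pair on `ℝ^σ × Z` (stiff box `T_Y` with window measure `μ = dy|_{T_Y}`, gauge factor `(Z, κ, D_Z)`)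
is `D = h₀² ⊗ D_Z`, `J_flat((y,z),(y',z')) = J(y,y')·D_Z(z)D_Z(z')/M_Z` (`J = h₀Kh₀/λ₀` the Mehler pair of ✓`…BOStiffMehlerExit`, independent resampling along `Z`).  The last
step of the `hflat` chain, R63 ✓`killed_transfer_door` on the finite measure space `(ℝ^σ × Z, μ⊗κ)`, needs the EXIT MASS of `J_flat` from the support `S` (the chart image of `cS`):
* §1 (model-free, finite measures `μ`, `κ`) `indicator_compl_le_of_core`, ★ `setIntegral_prod_compl_le_of_core`: if `q.1 ∈ B ∧ q.2 ∈ W ⇒ q ∈ S` then for non-negative bounded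
  measurable `f`, `g`: `∫_{Sᶜ} f(y')g(z') d(μ⊗κ) ≤ (∫_{Bᶜ}f dμ)(∫g dκ) + (∫f dμ)(∫_{Wᶜ}g dκ)`;
* §2 ★★★ `product_exit_mass_le` — THE (B2) ESTIMATE: for `μ ≤ dy` and `S` CORE-STABLE at scale `(t, W)` (`(y,z) ∈ S`, `|y'_k − ρ_ky_k| ≤ t`, `z' ∈ W` ⇒ `(y',z') ∈ S`, `ρ_k = b_k/s_k`):
  for every `p = (y,z) ∈ S`, `∫_{Sᶜ} J_flat(p,q) d(μ⊗κ)(q) ≤ (2n·e^{−πt²} + κ[D_Z𝟙_{Wᶜ}]/M_Z)·h₀(y)²D_Z(z)` (stiff part: the box tail of ✓`…BOStiffGaussTail` around the contracted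
  centre `ρy`, `mehlerJ_exit_shiftedBox_le`; gauge part: the resampling leaves `W` with probability `κ[D_Z𝟙_{Wᶜ}]/M_Z`);
* §3 ★ `coreStable_weightedBall` — the weighted balls `{Σ_k w_ky_k² + ‖z‖² ≤ r²}` (chart images of the Euclidean ball `cS` in Mehler-normalised stiff coordinates) are core-stable
  at every scale `(t,u)` with `(ρr + t√Σw)² + u² ≤ r²` (weighted Minkowski `sqrt_weightedSum_add_le` + contraction `ρ_k ≤ ρ`), `W = closedBall 0 u`.
Next file (hand C): `…BOStiffFlatPoincare` — the composition `mehler_poincare_box → variance_tensor_le_slack → (B2) → killed transfer` = `hflat` in flat coordinates.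
HONEST FRAMING: classical Gaussian bookkeeping for a stub of a child of the CONDITIONAL route R2b1; (B-ST) OPEN; C4-CORE OPEN; not infinite volume, not a gap, not Clay.

## References
* M. Fukushima, Y. Oshima, M. Takeda, *Dirichlet Forms and Symmetric Markov Processes*, de Gruyter 2011, §4.4 (part process, killing measure). [FukushimaOshimaTakeda2011]
* A. Wipf, *Statistical Approach to Quantum Field Theory*, LNP 992, Springer 2021, §8.5.1. [Wipf2021]
-/

set_option autoImplicit false

noncomputable section

open MeasureTheory Filter
open scoped Real

namespace Summit.QuantumFields.YangMills.Theorems.FemtoTransferGap.Mehler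

open Literature.Analysis.SegalBargmann

/-! ## §1 A product-measure exit bound from core stability (model-free) -/

section Core

variable {Y Z : Type*} [MeasurableSpace Y] [MeasurableSpace Z] {μ : Measure Y} {κ : Measure Z} [IsFiniteMeasure μ] [IsFiniteMeasure κ]

omit [MeasurableSpace Y] [MeasurableSpace Z] [IsFiniteMeasure μ] [IsFiniteMeasure κ] in
/-- **Core stability, contrapositive**: if `q.1 ∈ B ∧ q.2 ∈ W ⇒ q ∈ S`, then off `S` one of the two coordinates is off its core:
`𝟙_{Sᶜ}·F ≤ 𝟙_{Bᶜ × Z}·F + 𝟙_{Y × Wᶜ}·F` for `F ≥ 0`. [folklore] -/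
theorem indicator_compl_le_of_core {S : Set (Y × Z)} {B : Set Y} {W : Set Z} (hcore : ∀ q : Y × Z, q.1 ∈ B → q.2 ∈ W → q ∈ S)
    {F : Y × Z → ℝ} (hF0 : ∀ q, 0 ≤ F q) (q : Y × Z) :
    Sᶜ.indicator F q ≤ (Bᶜ ×ˢ (Set.univ : Set Z)).indicator F q + ((Set.univ : Set Y) ×ˢ Wᶜ).indicator F q := by
  have h1 : 0 ≤ (Bᶜ ×ˢ (Set.univ : Set Z)).indicator F q := Set.indicator_nonneg (fun x _ => hF0 x) q
  have h2 : 0 ≤ ((Set.univ : Set Y) ×ˢ Wᶜ).indicator F q := Set.indicator_nonneg (fun x _ => hF0 x) q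
  by_cases hq : q ∈ S
  · have hq' : q ∉ Sᶜ := fun h => (Set.mem_compl_iff S q).1 h hq
    rw [Set.indicator_of_notMem hq']
    exact add_nonneg h1 h2
  · rw [Set.indicator_of_mem (Set.mem_compl hq)]
    by_cases hy : q.1 ∈ B
    · have hz : q.2 ∉ W := fun hz => hq (hcore q hy hz)
      have hmem : q ∈ (Set.univ : Set Y) ×ˢ Wᶜ := ⟨Set.mem_univ _, hz⟩
      rw [Set.indicator_of_mem hmem]
      linarith
    · have hmem : q ∈ Bᶜ ×ˢ (Set.univ : Set Z) := ⟨hy, Set.mem_univ _⟩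
      rw [Set.indicator_of_mem hmem]
      linarith

/-- ★ **Exit of a product integrand from a core-stable set**: for non-negative bounded measurable `f` on `Y`, `g` on `Z`, finite measures, and `q.1 ∈ B ∧ q.2 ∈ W ⇒ q ∈ S`:
`∫_{Sᶜ} f(y')g(z') d(μ⊗κ) ≤ (∫_{Bᶜ} f dμ)(∫ g dκ) + (∫ f dμ)(∫_{Wᶜ} g dκ)`. [folklore] -/
theorem setIntegral_prod_compl_le_of_core {S : Set (Y × Z)} (hS : MeasurableSet S) {B : Set Y} (hB : MeasurableSet B) {W : Set Z} (hW : MeasurableSet W)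
    (hcore : ∀ q : Y × Z, q.1 ∈ B → q.2 ∈ W → q ∈ S)
    {f : Y → ℝ} (hfm : Measurable f) {Cf : ℝ} (hfb : ∀ y, |f y| ≤ Cf) (hf0 : ∀ y, 0 ≤ f y)
    {g : Z → ℝ} (hgm : Measurable g) {Cg : ℝ} (hgb : ∀ z, |g z| ≤ Cg) (hg0 : ∀ z, 0 ≤ g z) :
    ∫ q in Sᶜ, f q.1 * g q.2 ∂(μ.prod κ) ≤ (∫ y in Bᶜ, f y ∂μ) * (∫ z, g z ∂κ) + (∫ y, f y ∂μ) * ∫ z in Wᶜ, g z ∂κ := by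
  have hFm : Measurable fun q : Y × Z => f q.1 * g q.2 := (hfm.comp measurable_fst).mul (hgm.comp measurable_snd)
  have hFb : ∀ q : Y × Z, |f q.1 * g q.2| ≤ Cf * Cg := fun q => by
    rw [abs_mul]; exact mul_le_mul (hfb q.1) (hgb q.2) (abs_nonneg _) ((abs_nonneg _).trans (hfb q.1))
  have hFi : Integrable (fun q : Y × Z => f q.1 * g q.2) (μ.prod κ) := integrable_of_measurable_abs_le (μ.prod κ) hFm hFb
  have hF0 : ∀ q : Y × Z, 0 ≤ f q.1 * g q.2 := fun q => mul_nonneg (hf0 _) (hg0 _)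
  have h1 : ∫ q in Sᶜ, f q.1 * g q.2 ∂(μ.prod κ) ≤
      (∫ q in Bᶜ ×ˢ (Set.univ : Set Z), f q.1 * g q.2 ∂(μ.prod κ)) + ∫ q in (Set.univ : Set Y) ×ˢ Wᶜ, f q.1 * g q.2 ∂(μ.prod κ) := by
    rw [← integral_indicator hS.compl, ← integral_indicator (hB.compl.prod MeasurableSet.univ), ← integral_indicator (MeasurableSet.univ.prod hW.compl),
      ← integral_add (hFi.indicator (hB.compl.prod MeasurableSet.univ)) (hFi.indicator (MeasurableSet.univ.prod hW.compl))]
    exact integral_mono (hFi.indicator hS.compl) ((hFi.indicator (hB.compl.prod MeasurableSet.univ)).add (hFi.indicator (MeasurableSet.univ.prod hW.compl)))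
      fun q => indicator_compl_le_of_core hcore hF0 q
  rw [setIntegral_prod_mul, setIntegral_prod_mul, Measure.restrict_univ, Measure.restrict_univ] at h1
  exact h1

end Core

/-! ## §2 ★★★ (B2) The exit mass of the flat product kernel from a core-stable set -/

section ProductExit

variable {σ : Type*} [Fintype σ] [DecidableEq σ]
variable {Z : Type*} [MeasurableSpace Z] {κ : Measure Z} [IsFiniteMeasure κ]
variable {μ : Measure (σ → ℝ)} [IsFiniteMeasure μ]

omit [IsFiniteMeasure μ] in
/-- Rows of `J` against a sub-Lebesgue window measure `μ ≤ dy`: `∫_A J(y,·) dμ ≤ ∫_A J(y,·) dy`. [folklore] -/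
theorem setIntegral_mehlerJ_mono_measure {a b : σ → ℝ} (ha : ∀ k, 0 < a k) (hb : ∀ k, 0 < b k) (hab : ∀ k, a k ^ 2 + 2 * a k * b k = π ^ 2)
    (hμ : μ ≤ volume) (y : σ → ℝ) (A : Set (σ → ℝ)) :
    ∫ y' in A, hR 0 y * mehlerKernel a b y y' * hR 0 y' / ∏ k, Real.sqrt (π / (a k + b k + π)) ∂μ ≤
      ∫ y' in A, hR 0 y * mehlerKernel a b y y' * hR 0 y' / ∏ k, Real.sqrt (π / (a k + b k + π)) := by
  obtain ⟨-, hJ0, -⟩ := mehlerJ_admissible ha hb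
  obtain ⟨hJx, -, -⟩ := integral_mehlerJ_right ha hb hab
  exact integral_mono_measure (Measure.restrict_mono subset_rfl hμ) (ae_of_all _ fun y' => hJ0 y y') (hJx y).integrableOn

omit [IsFiniteMeasure μ] in
/-- ★ **Stiff exit from the contracted box, window version**: `∫_{y' ∉ ρy+[−t,t]^σ} J(y,y') dμ(y') ≤ 2n·e^{−πt²}·h₀(y)²` for any `μ ≤ dy`. [folklore] -/
theorem mehlerJ_exit_shiftedBox_le {a b : σ → ℝ} (ha : ∀ k, 0 < a k) (hb : ∀ k, 0 < b k) (hab : ∀ k, a k ^ 2 + 2 * a k * b k = π ^ 2)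
    (hμ : μ ≤ volume) (y : σ → ℝ) {t : ℝ} (ht : 0 ≤ t) :
    ∫ y' in {y' : σ → ℝ | ∀ k, |y' k - b k / (a k + b k + π) * y k| ≤ t}ᶜ,
        hR 0 y * mehlerKernel a b y y' * hR 0 y' / ∏ k, Real.sqrt (π / (a k + b k + π)) ∂μ ≤
      (2 * Fintype.card σ * Real.exp (-(π * t ^ 2))) * hR 0 y ^ 2 := by
  have hs : ∀ k, 0 < a k + b k + π := prec_pos ha hb
  have hL0 := lambda0_pos ha hb
  refine (setIntegral_mehlerJ_mono_measure ha hb hab hμ y _).trans ?_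
  rw [setIntegral_mehlerJ_eq ha hb hab y]
  have htail := integral_gaussShift_compl_box_le hs (fun k => b k / (a k + b k + π) * y k) ht
  have hsum := tailSum_le ha hb hab t
  have h0 : 0 ≤ hR 0 y ^ 2 / ∏ k, Real.sqrt (π / (a k + b k + π)) := div_nonneg (sq_nonneg _) hL0.le
  calc hR 0 y ^ 2 / (∏ k, Real.sqrt (π / (a k + b k + π))) *
        ∫ y' in {y' : σ → ℝ | ∀ k, |y' k - b k / (a k + b k + π) * y k| ≤ t}ᶜ, Real.exp (-∑ k, (a k + b k + π) * (y' k - b k / (a k + b k + π) * y k) ^ 2)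
      ≤ hR 0 y ^ 2 / (∏ k, Real.sqrt (π / (a k + b k + π))) *
          ((2 * Fintype.card σ * Real.exp (-(π * t ^ 2))) * ∏ k, Real.sqrt (π / (a k + b k + π))) :=
        mul_le_mul_of_nonneg_left (htail.trans (mul_le_mul_of_nonneg_right hsum hL0.le)) h0
    _ = (2 * Fintype.card σ * Real.exp (-(π * t ^ 2))) * hR 0 y ^ 2 := by field_simp

omit [IsFiniteMeasure μ] in
/-- Full rows against the window: `∫ J(y,·) dμ ≤ h₀(y)²` for `μ ≤ dy`. [folklore] -/
theorem integral_mehlerJ_window_le {a b : σ → ℝ} (ha : ∀ k, 0 < a k) (hb : ∀ k, 0 < b k) (hab : ∀ k, a k ^ 2 + 2 * a k * b k = π ^ 2)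
    (hμ : μ ≤ volume) (y : σ → ℝ) :
    ∫ y', hR 0 y * mehlerKernel a b y y' * hR 0 y' / ∏ k, Real.sqrt (π / (a k + b k + π)) ∂μ ≤ hR 0 y ^ 2 := by
  obtain ⟨-, hrow, -⟩ := integral_mehlerJ_right ha hb hab
  have h := setIntegral_mehlerJ_mono_measure (μ := μ) ha hb hab hμ y Set.univ
  rw [Measure.restrict_univ, Measure.restrict_univ, hrow y] at h
  exact h

/-- ★★★ **(B2) THE EXIT MASS OF THE PRODUCT KERNEL `J ⊗ D_ZD_Z'/M_Z` FROM A CORE-STABLE SET.**  `μ ≤ dy` a finite window measure on `ℝ^σ`, `κ` finite on `Z`, `0 ≤ D_Z ≤ C_Z`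
measurable with `M_Z = ∫D_Z dκ > 0`; `S ⊆ ℝ^σ × Z` measurable and CORE-STABLE at scale `(t, W)`: `(y,z) ∈ S`, `|y'_k − ρ_k y_k| ≤ t ∀k`, `z' ∈ W` ⇒ `(y',z') ∈ S`
(`ρ_k = b_k/s_k`: the stiff transition contracts towards the origin, the gauge coordinate is resampled from `D_Z`).  Then for every `p = (y,z) ∈ S`:
`∫_{Sᶜ} J(y,y')·D_Z(z)D_Z(z')/M_Z d(μ⊗κ)(y',z') ≤ (2n·e^{−πt²} + κ[D_Z𝟙_{Wᶜ}]/M_Z)·h₀(y)²D_Z(z)` — the exit hypothesis `hκ` of the killed transfer on `ℝ^σ × Z`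
with the flat weight `D = h₀² ⊗ D_Z`. [folklore] -/
theorem product_exit_mass_le {a b : σ → ℝ} (ha : ∀ k, 0 < a k) (hb : ∀ k, 0 < b k) (hab : ∀ k, a k ^ 2 + 2 * a k * b k = π ^ 2) (hμ : μ ≤ volume)
    {DZ : Z → ℝ} (hDZ : Measurable DZ) {CZ : ℝ} (hDZb : ∀ z, |DZ z| ≤ CZ) (hDZ0 : ∀ z, 0 ≤ DZ z) (hMZ : 0 < ∫ z, DZ z ∂κ)
    {S : Set ((σ → ℝ) × Z)} (hS : MeasurableSet S) {t : ℝ} (ht : 0 ≤ t) {W : Set Z} (hW : MeasurableSet W)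
    (hcore : ∀ p ∈ S, ∀ q : (σ → ℝ) × Z, (∀ k, |q.1 k - b k / (a k + b k + π) * p.1 k| ≤ t) → q.2 ∈ W → q ∈ S)
    {p : (σ → ℝ) × Z} (hp : p ∈ S) :
    ∫ q in Sᶜ, (hR 0 p.1 * mehlerKernel a b p.1 q.1 * hR 0 q.1 / ∏ k, Real.sqrt (π / (a k + b k + π))) * (DZ p.2 * DZ q.2 / ∫ z, DZ z ∂κ) ∂(μ.prod κ) ≤
      (2 * Fintype.card σ * Real.exp (-(π * t ^ 2)) + (∫ z in Wᶜ, DZ z ∂κ) / ∫ z, DZ z ∂κ) * (hR 0 p.1 ^ 2 * DZ p.2) := by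
  obtain ⟨-, hJ0, -, hJb, -⟩ := mehlerJ_admissible ha hb
  -- the two factors
  have hfm : Measurable fun y' : σ → ℝ => hR 0 p.1 * mehlerKernel a b p.1 y' * hR 0 y' / ∏ k, Real.sqrt (π / (a k + b k + π)) :=
    (((continuous_const.mul (continuous_mehlerKernel_right a b p.1)).mul continuous_hR_zero).div_const _).measurable
  have hgm : Measurable fun z' : Z => DZ p.2 * DZ z' / ∫ z, DZ z ∂κ := (hDZ.const_mul _).div_const _
  have hgb : ∀ z', |DZ p.2 * DZ z' / ∫ z, DZ z ∂κ| ≤ CZ * CZ / ∫ z, DZ z ∂κ := fun z' => by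
    rw [abs_div, abs_of_pos hMZ, abs_mul]
    exact div_le_div_of_nonneg_right (mul_le_mul (hDZb p.2) (hDZb z') (abs_nonneg _) ((abs_nonneg _).trans (hDZb p.2))) hMZ.le
  have hg0 : ∀ z', 0 ≤ DZ p.2 * DZ z' / ∫ z, DZ z ∂κ := fun z' => div_nonneg (mul_nonneg (hDZ0 _) (hDZ0 _)) hMZ.le
  -- (1) the core split
  have h1 := setIntegral_prod_compl_le_of_core (μ := μ) (κ := κ) hS (measurableSet_box (fun k => b k / (a k + b k + π) * p.1 k) t) hW
    (fun q hy hz => hcore p hp q hy hz) hfm (fun y' => hJb p.1 y') (fun y' => hJ0 p.1 y') hgm hgb hg0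
  -- (2) the gauge factors: `∫ g = D_Z(z)`, `∫_{Wᶜ} g = D_Z(z)·κ[D_Z𝟙_{Wᶜ}]/M_Z`
  have e2 : ∫ z', DZ p.2 * DZ z' / ∫ z, DZ z ∂κ ∂κ = DZ p.2 := by
    have e : (fun z' => DZ p.2 * DZ z' / ∫ z, DZ z ∂κ) = fun z' => (DZ p.2 / ∫ z, DZ z ∂κ) * DZ z' := funext fun z' => by ring
    rw [e, integral_const_mul, div_mul_cancel₀ _ hMZ.ne']
  have e3 : ∫ z' in Wᶜ, DZ p.2 * DZ z' / ∫ z, DZ z ∂κ ∂κ = DZ p.2 * (∫ z' in Wᶜ, DZ z' ∂κ) / ∫ z, DZ z ∂κ := by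
    have e : (fun z' => DZ p.2 * DZ z' / ∫ z, DZ z ∂κ) = fun z' => (DZ p.2 / ∫ z, DZ z ∂κ) * DZ z' := funext fun z' => by ring
    rw [e, integral_const_mul]
    ring
  rw [e2, e3] at h1
  -- (3) the stiff factors
  have h2 := mehlerJ_exit_shiftedBox_le (μ := μ) ha hb hab hμ p.1 ht
  have h3 := integral_mehlerJ_window_le (μ := μ) ha hb hab hμ p.1
  have hWint : 0 ≤ ∫ z' in Wᶜ, DZ z' ∂κ := integral_nonneg fun z' => hDZ0 z'
  -- assemble
  refine h1.trans ?_
  have t1 : (∫ y' in {y' : σ → ℝ | ∀ k, |y' k - b k / (a k + b k + π) * p.1 k| ≤ t}ᶜ,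
        hR 0 p.1 * mehlerKernel a b p.1 y' * hR 0 y' / ∏ k, Real.sqrt (π / (a k + b k + π)) ∂μ) * DZ p.2 ≤
      (2 * Fintype.card σ * Real.exp (-(π * t ^ 2))) * hR 0 p.1 ^ 2 * DZ p.2 := mul_le_mul_of_nonneg_right h2 (hDZ0 _)
  have t2 : (∫ y', hR 0 p.1 * mehlerKernel a b p.1 y' * hR 0 y' / ∏ k, Real.sqrt (π / (a k + b k + π)) ∂μ) *
        (DZ p.2 * (∫ z' in Wᶜ, DZ z' ∂κ) / ∫ z, DZ z ∂κ) ≤ hR 0 p.1 ^ 2 * (DZ p.2 * (∫ z' in Wᶜ, DZ z' ∂κ) / ∫ z, DZ z ∂κ) :=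
    mul_le_mul_of_nonneg_right h3 (div_nonneg (mul_nonneg (hDZ0 _) hWint) hMZ.le)
  calc _ ≤ (2 * Fintype.card σ * Real.exp (-(π * t ^ 2))) * hR 0 p.1 ^ 2 * DZ p.2 + hR 0 p.1 ^ 2 * (DZ p.2 * (∫ z' in Wᶜ, DZ z' ∂κ) / ∫ z, DZ z ∂κ) :=
        add_le_add t1 t2
    _ = (2 * Fintype.card σ * Real.exp (-(π * t ^ 2)) + (∫ z in Wᶜ, DZ z ∂κ) / ∫ z, DZ z ∂κ) * (hR 0 p.1 ^ 2 * DZ p.2) := by ring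

end ProductExit

/-! ## §3 ★ Weighted balls are core-stable (the chart image of the support `cS`) -/

section WeightedBall

variable {σ : Type*} [Fintype σ] {Z : Type*} [SeminormedAddCommGroup Z]

omit [Fintype σ] in
/-- **Weighted Minkowski**: `√(Σ w_k(u_k+v_k)²) ≤ √(Σ w_ku_k²) + √(Σ w_kv_k²)` for `w ≥ 0`. [folklore] -/
theorem sqrt_weightedSum_add_le (s : Finset σ) {w : σ → ℝ} (hw : ∀ k, 0 ≤ w k) (u v : σ → ℝ) :
    Real.sqrt (∑ k ∈ s, w k * (u k + v k) ^ 2) ≤ Real.sqrt (∑ k ∈ s, w k * u k ^ 2) + Real.sqrt (∑ k ∈ s, w k * v k ^ 2) := by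
  have hA : 0 ≤ ∑ k ∈ s, w k * u k ^ 2 := Finset.sum_nonneg fun k _ => mul_nonneg (hw k) (sq_nonneg _)
  have hB : 0 ≤ ∑ k ∈ s, w k * v k ^ 2 := Finset.sum_nonneg fun k _ => mul_nonneg (hw k) (sq_nonneg _)
  -- Cauchy–Schwarz for `f = √w·u`, `g = √w·v`
  have hcs := Real.sum_mul_le_sqrt_mul_sqrt s (fun k => Real.sqrt (w k) * u k) (fun k => Real.sqrt (w k) * v k)
  have ef : ∑ k ∈ s, (Real.sqrt (w k) * u k) ^ 2 = ∑ k ∈ s, w k * u k ^ 2 :=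
    Finset.sum_congr rfl fun k _ => by rw [mul_pow, Real.sq_sqrt (hw k)]
  have eg : ∑ k ∈ s, (Real.sqrt (w k) * v k) ^ 2 = ∑ k ∈ s, w k * v k ^ 2 :=
    Finset.sum_congr rfl fun k _ => by rw [mul_pow, Real.sq_sqrt (hw k)]
  have efg : ∑ k ∈ s, (Real.sqrt (w k) * u k) * (Real.sqrt (w k) * v k) = ∑ k ∈ s, w k * (u k * v k) :=
    Finset.sum_congr rfl fun k _ => by
      have := Real.mul_self_sqrt (hw k)
      calc Real.sqrt (w k) * u k * (Real.sqrt (w k) * v k) = (Real.sqrt (w k) * Real.sqrt (w k)) * (u k * v k) := by ring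
        _ = w k * (u k * v k) := by rw [this]
  rw [ef, eg, efg] at hcs
  -- expand the square
  have hexp : ∑ k ∈ s, w k * (u k + v k) ^ 2 = (∑ k ∈ s, w k * u k ^ 2) + 2 * (∑ k ∈ s, w k * (u k * v k)) + ∑ k ∈ s, w k * v k ^ 2 := by
    rw [Finset.mul_sum, ← Finset.sum_add_distrib, ← Finset.sum_add_distrib]
    exact Finset.sum_congr rfl fun k _ => by ring
  have hsq : ∑ k ∈ s, w k * (u k + v k) ^ 2 ≤ (Real.sqrt (∑ k ∈ s, w k * u k ^ 2) + Real.sqrt (∑ k ∈ s, w k * v k ^ 2)) ^ 2 := by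
    rw [hexp, add_sq, Real.sq_sqrt hA, Real.sq_sqrt hB]
    nlinarith [hcs]
  calc Real.sqrt (∑ k ∈ s, w k * (u k + v k) ^ 2) ≤ Real.sqrt ((Real.sqrt (∑ k ∈ s, w k * u k ^ 2) + Real.sqrt (∑ k ∈ s, w k * v k ^ 2)) ^ 2) :=
        Real.sqrt_le_sqrt hsq
    _ = _ := Real.sqrt_sq (add_nonneg (Real.sqrt_nonneg _) (Real.sqrt_nonneg _))

/-- ★ **WEIGHTED BALLS ARE CORE-STABLE.**  `S = {(y,z) | Σ_k w_k y_k² + ‖z‖² ≤ r²}` (`w_k ≥ 0`; the chart image of a Euclidean ball when the stiff coordinates are Mehler-normalised),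
`0 ≤ ρ_k ≤ ρ`, `0 ≤ ρ`, and scales `t, u ≥ 0` with `(ρ·r + t·√(Σ_k w_k))² + u² ≤ r²` (e.g. `t = (1−ρ)r/(2√Σw)`, `u = (1−ρ)r/2`).  Then `(y,z) ∈ S`, `|y'_k − ρ_k y_k| ≤ t ∀k`,
`‖z'‖ ≤ u` ⇒ `(y',z') ∈ S` — the hypothesis `hcore` of `product_exit_mass_le` with `W = closedBall 0 u`. [folklore] -/
theorem coreStable_weightedBall {w : σ → ℝ} (hw : ∀ k, 0 ≤ w k) {r : ℝ} (hr : 0 ≤ r) {ρ' : σ → ℝ} (hρ0 : ∀ k, 0 ≤ ρ' k) {ρ : ℝ} (hρ : 0 ≤ ρ)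
    (hρ' : ∀ k, ρ' k ≤ ρ) {t u : ℝ} (ht : 0 ≤ t) (hfit : (ρ * r + t * Real.sqrt (∑ k, w k)) ^ 2 + u ^ 2 ≤ r ^ 2)
    {p : (σ → ℝ) × Z} (hp : p ∈ {p : (σ → ℝ) × Z | ∑ k, w k * p.1 k ^ 2 + ‖p.2‖ ^ 2 ≤ r ^ 2})
    (q : (σ → ℝ) × Z) (hq1 : ∀ k, |q.1 k - ρ' k * p.1 k| ≤ t) (hq2 : q.2 ∈ Metric.closedBall (0 : Z) u) :
    q ∈ {p : (σ → ℝ) × Z | ∑ k, w k * p.1 k ^ 2 + ‖p.2‖ ^ 2 ≤ r ^ 2} := by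
  rw [Set.mem_setOf_eq] at hp ⊢
  rw [Metric.mem_closedBall, dist_zero_right] at hq2
  have hu : 0 ≤ u := (norm_nonneg _).trans hq2
  have hW : 0 ≤ ∑ k, w k := Finset.sum_nonneg fun k _ => hw k
  -- `A = √(Σ w y²) ≤ r`
  have hA2 : ∑ k, w k * p.1 k ^ 2 ≤ r ^ 2 := by nlinarith [norm_nonneg p.2]
  have hA : Real.sqrt (∑ k, w k * p.1 k ^ 2) ≤ r := by
    calc Real.sqrt (∑ k, w k * p.1 k ^ 2) ≤ Real.sqrt (r ^ 2) := Real.sqrt_le_sqrt hA2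
      _ = r := Real.sqrt_sq hr
  -- Minkowski: `√(Σ w y'²) ≤ √(Σ w (ρ'y)²) + √(Σ w (y' − ρ'y)²)`
  have hM := sqrt_weightedSum_add_le Finset.univ hw (fun k => ρ' k * p.1 k) (fun k => q.1 k - ρ' k * p.1 k)
  have e0 : ∑ k, w k * (ρ' k * p.1 k + (q.1 k - ρ' k * p.1 k)) ^ 2 = ∑ k, w k * q.1 k ^ 2 := Finset.sum_congr rfl fun k _ => by ring
  rw [e0] at hM
  -- the contracted centre: `√(Σ w (ρ'y)²) ≤ ρ·r`
  have h1 : Real.sqrt (∑ k, w k * (ρ' k * p.1 k) ^ 2) ≤ ρ * r := by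
    have h1a : ∑ k, w k * (ρ' k * p.1 k) ^ 2 ≤ ρ ^ 2 * ∑ k, w k * p.1 k ^ 2 := by
      rw [Finset.mul_sum]
      refine Finset.sum_le_sum fun k _ => ?_
      have hk : ρ' k ^ 2 ≤ ρ ^ 2 := pow_le_pow_left₀ (hρ0 k) (hρ' k) 2
      nlinarith [hw k, sq_nonneg (p.1 k), mul_nonneg (hw k) (sq_nonneg (p.1 k))]
    calc Real.sqrt (∑ k, w k * (ρ' k * p.1 k) ^ 2) ≤ Real.sqrt (ρ ^ 2 * ∑ k, w k * p.1 k ^ 2) := Real.sqrt_le_sqrt h1a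
      _ = ρ * Real.sqrt (∑ k, w k * p.1 k ^ 2) := by rw [Real.sqrt_mul (sq_nonneg ρ), Real.sqrt_sq hρ]
      _ ≤ ρ * r := mul_le_mul_of_nonneg_left hA hρ
  -- the stiff step: `√(Σ w (y' − ρ'y)²) ≤ t·√(Σ w)`
  have h2 : Real.sqrt (∑ k, w k * (q.1 k - ρ' k * p.1 k) ^ 2) ≤ t * Real.sqrt (∑ k, w k) := by
    have h2a : ∑ k, w k * (q.1 k - ρ' k * p.1 k) ^ 2 ≤ t ^ 2 * ∑ k, w k := by
      rw [Finset.mul_sum]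
      refine Finset.sum_le_sum fun k _ => ?_
      have hk : (q.1 k - ρ' k * p.1 k) ^ 2 ≤ t ^ 2 := by
        rw [← sq_abs]; exact pow_le_pow_left₀ (abs_nonneg _) (hq1 k) 2
      nlinarith [hw k]
    calc Real.sqrt (∑ k, w k * (q.1 k - ρ' k * p.1 k) ^ 2) ≤ Real.sqrt (t ^ 2 * ∑ k, w k) := Real.sqrt_le_sqrt h2a
      _ = t * Real.sqrt (∑ k, w k) := by rw [Real.sqrt_mul (sq_nonneg t), Real.sqrt_sq ht]
  -- assemble
  have hN : Real.sqrt (∑ k, w k * q.1 k ^ 2) ≤ ρ * r + t * Real.sqrt (∑ k, w k) := hM.trans (add_le_add h1 h2)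
  have hN0 : 0 ≤ ∑ k, w k * q.1 k ^ 2 := Finset.sum_nonneg fun k _ => mul_nonneg (hw k) (sq_nonneg _)
  have hN2 : ∑ k, w k * q.1 k ^ 2 ≤ (ρ * r + t * Real.sqrt (∑ k, w k)) ^ 2 := by
    calc ∑ k, w k * q.1 k ^ 2 = Real.sqrt (∑ k, w k * q.1 k ^ 2) ^ 2 := (Real.sq_sqrt hN0).symm
      _ ≤ (ρ * r + t * Real.sqrt (∑ k, w k)) ^ 2 := pow_le_pow_left₀ (Real.sqrt_nonneg _) hN 2
  have hz2 : ‖q.2‖ ^ 2 ≤ u ^ 2 := pow_le_pow_left₀ (norm_nonneg _) hq2 2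
  linarith

end WeightedBall

end Summit.QuantumFields.YangMills.Theorems.FemtoTransferGap.Mehler

end
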